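import Summits.AtomisticToContinuum.FouriersLaw.Theses.CoercivePulse
import Summits.AtomisticToContinuum.FouriersLaw.Theorems.CoercivePulseFouriersLawOfBridge
import Summits.AtomisticToContinuum.FouriersLaw.Theorems.CoercivePulseLinearSpreadStubHelfandIdentity
import Summits.AtomisticToContinuum.FouriersLaw.Theorems.HoelderEscapeProfileLocalEnergyHalfHoelderStubPulseMomentGuard
import Summits.AtomisticToContinuum.FouriersLaw.Theorems.HoelderEscapeProfileFibreCalculus
import Summits.AtomisticToContinuum.FouriersLaw.Theorems.JunctionLocalityConductanceLowerBoundStubBulkAbelFloorOfHeatVarianceBets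
import Summits.AtomisticToContinuum.FouriersLaw.Theorems.CageBudgetFeketeUnboundedHeatVarianceOfLinearSpread
import HarnessLib

/-!
# The converse edge without `PulseCalculus`: `LinearSpread → UniformAbelianRegularity → ConductanceLowerBound` (and `→ FouriersLaw`)
(crux `CoercivePulse.LinearSpread`, item stmt-AtomisticToContinuum-15382; `--supports` file, closes nothing; lead of line `KaramataCollapse`,
2026-08-17, cycle 1)

WHAT. Together with `linearSpread_of_bridge : UniformAbelianRegularity → ConductanceLowerBound → LinearSpread` (p167884) this file makes the
statement "modulo (R) = stmt-13416, the route's positivity crux `LinearSpread` IS the shared positivity child CLB = stmt-11749" a pair of tree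
theorems with NO further hypothesis:

* `bulkAbelFloor_of_linearSpread'` — `LinearSpread →` a bulk Abel floor witness at every `T > 0` (shift-invariant DLR state, preserving
  dynamics with absolutely convergent correlations, `a ≤ ∫₀^∞e^{−νt}C_T` on `(0,ν₀)`). Compared with the landed `bulkAbelFloor_of_linearSpread`
  (p157637) the hypotheses `SymmetricSetup` and `PulseCalculus` are DISCHARGED: the pair is the proved `coercivePulse_symmetricSetup_proof`, the
  guard `Σ(1+x²)|S(x,t)| < ∞` is the landed `pulseMomentGuard` (its Laplace-integrability premise from the proved `FibreCalculus`, clause 3),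
  Helfand's identity is the landed `stub_helfandIdentity`, and the Laplace identity `∫e^{−νt}C_T = (ν²/2)∫e^{−νt}V` is the proved
  `HeatVarianceCalculus`; then the affine floor `V(t) ≥ m·t − K` (`t > 0`) gives `Â(ν) ≥ m/2 − Kν/2 ≥ m/4`.
* `conductanceLowerBound_of_linearSpread_of_regularity` — `LinearSpread → UniformAbelianRegularity → ConductanceLowerBound`, by the landed
  bridges of line `abel-floor-exchange` of stmt-11749 (`abelFloor_openChain_of_bulkWitness`, `slowRegularity_signed_of_uniformAbelianRegularity`,
  `conductanceLowerBound_of_abelFloor_and_signedSlowRegularity`).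
* `fouriersLaw_of_linearSpread_of_regularity` — `LinearSpread → UniformAbelianRegularity → FouriersLaw` (through `fouriersLaw_of_bridge`,
  p167957): on route CoercivePulse the conjunct follows from the rank-2 bet and (R) alone.
No definitions, no named facts. [cite: KunduDharNarayan2009, p. 3] [cite: Helfand1960, §II]
-/

noncomputable section

namespace Summit.AtomisticToContinuum.FouriersLaw.Theorems.LinearSpread.KaramataCollapse

open MeasureTheory Filter Set
open scoped Topology BigOperators
open Literature.MathematicalPhysics.KineticTheory.HeatConduction

/-- **Bulk Abel floor from `LinearSpread` alone.** For `pinnedChain ω₂ lam β γ` (all `> 0`) and `T > 0`: `CoercivePulse.LinearSpread`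
implies a bulk Abel floor witness — the proved symmetric pair `(μ_T, D)`, `a = m/4`, `ν₀ = m/(2(K+1))` — with the guard, Helfand's identity
and the Laplace identity all taken from landed theorems (no `PulseCalculus`, no `SymmetricSetup` hypothesis). [cite: Helfand1960, §II] -/
theorem bulkAbelFloor_of_linearSpread' :
    Summit.AtomisticToContinuum.FouriersLaw.Theses.CoercivePulse.LinearSpread →
    ∀ ω₂ lam β γ : ℝ, 0 < ω₂ → 0 < lam → 0 < β → 0 < γ → ∀ T : ℝ, 0 < T →
      ∃ (μT : Measure ChainConfig) (D : InfiniteChainDynamics (pinnedChain ω₂ lam β γ)) (a ν₀ : ℝ),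
        (pinnedChain ω₂ lam β γ).IsChainGibbsMeasure T μT ∧ IsShiftInvariant μT ∧
        D.PreservesMeasure μT ∧ (∀ t : ℝ, D.HasAbsConvergentCorrelation μT t) ∧ 0 < a ∧ 0 < ν₀ ∧
        ∀ ν : ℝ, 0 < ν → ν < ν₀ →
          a ≤ ∫ t in Set.Ioi (0:ℝ), Real.exp (-(ν * t)) * D.currentCorrelation μT t := by
  intro hLS ω₂ lam β γ hω hl hβ _hγ T hT
  -- the guarded pair (proved `SymmetricSetup`)
  obtain ⟨μT, hG, hSI, hRefl, D, hP, hShift⟩ :=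
    Summit.AtomisticToContinuum.FouriersLaw.Theorems.CurrentTiltQuench.coercivePulse_symmetricSetup_proof ω₂ lam β γ hω hl hβ T hT
  -- the split-bond site energy `h` and the pulse `S`
  set h : ChainConfig → ℤ → ℝ := fun σ x => (σ x).2 ^ 2 / 2 + (pinnedChain ω₂ lam β γ).U (σ x).1 +
      ((pinnedChain ω₂ lam β γ).V ((σ (x + 1)).1 - (σ x).1) +
        (pinnedChain ω₂ lam β γ).V ((σ x).1 - (σ (x - 1)).1)) / 2 with hh
  set S : ℤ → ℝ → ℝ := fun x t =>
      ∫ σ, (h σ 0 - ∫ σ', h σ' 0 ∂μT) * (h (D.flow t σ) x - ∫ σ', h σ' 0 ∂μT) ∂μT with hS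
  -- the guard at every time (landed `pulseMomentGuard`; its Laplace premise from the proved `FibreCalculus`, clause 3)
  have hFC := Summit.AtomisticToContinuum.FouriersLaw.Theorems.FibreCalculusSketch.fibreCalculus_proof
    ω₂ lam β γ hω hl hβ T hT μT hG hSI hRefl D hP hShift h hh S hS _ rfl _ rfl _ rfl _ rfl _ rfl
  have hIntS : ∀ ν : ℝ, 0 < ν → IntegrableOn (fun t : ℝ => Real.exp (-(ν * t)) * S 0 t) (Ioi 0) :=
    fun ν hν => hFC.2.2.1 0 ν hν
  have hsum : ∀ t : ℝ, Summable (fun x : ℤ => (1 + (x : ℝ) ^ 2) * |S x t|) :=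
    Summit.AtomisticToContinuum.FouriersLaw.Theorems.LocalEnergyHalfHoelder.NashDoubling.pulseMomentGuard
      ω₂ lam β γ hω hl hβ T hT μT hG hSI hRefl D hP hShift h hh S hS hIntS
  obtain ⟨m, t₂, hm, hspread⟩ := hLS ω₂ lam β γ hω hl hβ T hT μT hG hSI hRefl D hP hShift h hh S hS hsum
  -- the heat variance (proved `HeatVarianceCalculus`) and Helfand's identity (landed stub)
  obtain ⟨hAC, -, hVc⟩ :=
    Summit.AtomisticToContinuum.FouriersLaw.Theorems.HeatVarianceCalculus.CanonicalRigidity.heatVarianceCalculus_proof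
      ω₂ lam β γ hω hl hβ T hT μT hG hSI hRefl D hP hShift
  obtain ⟨V, hV⟩ : ∃ V : ℝ → ℝ, V = (fun τ : ℝ => 2 * ∫ s in Set.Ioc (0:ℝ) τ, (τ - s) * D.currentCorrelation μT s) :=
    ⟨_, rfl⟩
  obtain ⟨hV0, hLap⟩ := hVc V hV
  set M : ℝ → ℝ := fun t => ∑' x : ℤ, (x : ℝ) ^ 2 * S x t with hM
  have hHelf : ∀ t : ℝ, 0 ≤ t → M t - M 0 = V t := fun t ht => by
    rw [hV]; exact stub_helfandIdentity ω₂ lam β γ hω hl hβ T hT μT hG hSI hRefl D hP hShift h hh S hS hsum t ht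
  -- the affine floor `m t − K ≤ V t` for `t > 0`
  set T₂ : ℝ := max t₂ 0 with hT₂
  set K : ℝ := |M 0| + m * T₂ with hK
  have hK0 : 0 ≤ K := by positivity
  have hlow : ∀ t : ℝ, 0 < t → m * t + (-K) ≤ V t := by
    intro t ht
    rcases le_or_gt T₂ t with hle | hlt
    · have h1 : m * t ≤ M t := hspread t ((le_max_left _ _).trans hle)
      rw [← hHelf t ht.le]
      have h3 : M 0 ≤ |M 0| := le_abs_self _
      have h4 : 0 ≤ m * T₂ := by positivity
      linarith
    · have h1 : 0 ≤ V t := hV0 t ht.le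
      have h3 : m * t ≤ m * T₂ := mul_le_mul_of_nonneg_left hlt.le hm.le
      have h4 : 0 ≤ |M 0| := abs_nonneg _
      linarith
  -- the Abelian lower bound `Â(ν) ≥ m/2 − Kν/2`
  set A : ℝ → ℝ := fun ν => ∫ t in Ioi (0:ℝ), Real.exp (-(ν * t)) * D.currentCorrelation μT t with hAd
  have hAlow : ∀ ν : ℝ, 0 < ν → m / 2 - K / 2 * ν ≤ A ν := by
    intro ν hν
    obtain ⟨iL, vL⟩ :=
      Summit.AtomisticToContinuum.FouriersLaw.Theorems.UnboundedHeatVariance.Birth.integral_exp_neg_mul_affine hν m (-K)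
    have cL := setIntegral_mono_on iL (hLap ν hν).2.1 measurableSet_Ioi
      fun t ht => mul_le_mul_of_nonneg_left (hlow t ht) (Real.exp_pos (-(ν * t))).le
    rw [vL] at cL
    have e : ν ^ 2 / 2 * (m * (ν ^ 2)⁻¹ + -K * ν⁻¹) = m / 2 - K / 2 * ν := by
      field_simp; ring
    show m / 2 - K / 2 * ν ≤ ∫ t in Ioi (0:ℝ), Real.exp (-(ν * t)) * D.currentCorrelation μT t
    rw [(hLap ν hν).2.2, ← e]
    exact mul_le_mul_of_nonneg_left cL (by positivity)
  -- the witness: `a = m/4`, `ν₀ = m/(2(K+1))`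
  refine ⟨μT, D, m / 4, m / (2 * (K + 1)), hG, hSI, hP, hAC, by positivity, by positivity, fun ν hν hνlt => ?_⟩
  have h1 := hAlow ν hν
  have h2 : K / 2 * ν ≤ m / 4 := by
    have h3 : ν * (2 * (K + 1)) < m := by
      have := (lt_div_iff₀ (show 0 < 2 * (K + 1) by positivity)).mp hνlt
      linarith
    nlinarith
  show m / 4 ≤ A ν
  linarith

/-- **`LinearSpread → UniformAbelianRegularity → ConductanceLowerBound`** (registered glue stub, verbatim): on route CoercivePulse the shared
positivity child CLB (stmt-11749) follows from the rank-2 bet and (R) (stmt-13416; only its lower half is used) — bulk Abel floor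
(`bulkAbelFloor_of_linearSpread'`) ⇒ open-chain Abel floor at fixed frequency (landed matching) and the Kubo identity (landed bridges of
line `abel-floor-exchange`). The converse of `linearSpread_of_bridge` modulo (R). [cite: KunduDharNarayan2009, p. 3] -/
theorem conductanceLowerBound_of_linearSpread_of_regularity : Summit.AtomisticToContinuum.FouriersLaw.Theses.CoercivePulse.LinearSpread → Summit.AtomisticToContinuum.FouriersLaw.Theses.CoercivePulse.UniformAbelianRegularity → Summit.AtomisticToContinuum.FouriersLaw.Theses.CoercivePulse.ConductanceLowerBound :=
  fun hLS hR =>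
    Summit.AtomisticToContinuum.FouriersLaw.Cruxes.ConductanceLowerBound.AbelFloorExchange.conductanceLowerBound_of_abelFloor_and_signedSlowRegularity
      (Summit.AtomisticToContinuum.FouriersLaw.Cruxes.ConductanceLowerBound.AbelFloorExchange.abelFloor_openChain_of_bulkWitness
        (bulkAbelFloor_of_linearSpread' hLS))
      (Summit.AtomisticToContinuum.FouriersLaw.Cruxes.ConductanceLowerBound.AbelFloorExchange.slowRegularity_signed_of_uniformAbelianRegularity
        hR)

/-- **`LinearSpread → UniformAbelianRegularity → FouriersLaw`** (registered glue stub, verbatim): on route CoercivePulse the conjunct follows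
from the rank-2 bet `LinearSpread` and (R) alone (`fouriersLaw_of_bridge` fed `conductanceLowerBound_of_linearSpread_of_regularity`); the
cruxes `LinearCeiling`, `AbelRegularity`, `AbelThermodynamicLimit`, `PulseCalculus` of the route's `closes` are dispensable.
[cite: BonettoLebowitzReyBellet2000, §7 eq. (37)] -/
theorem fouriersLaw_of_linearSpread_of_regularity : Summit.AtomisticToContinuum.FouriersLaw.Theses.CoercivePulse.LinearSpread → Summit.AtomisticToContinuum.FouriersLaw.Theses.CoercivePulse.UniformAbelianRegularity → _root_.FouriersLaw :=
  fun hLS hR => fouriersLaw_of_bridge hR (conductanceLowerBound_of_linearSpread_of_regularity hLS hR)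

end Summit.AtomisticToContinuum.FouriersLaw.Theorems.LinearSpread.KaramataCollapse

end
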